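import Summits.QuantumFields.YangMills.Theorems.BalabanUVNodesN15KingModelGraphPowerCountingOrderings
import Summits.QuantumFields.YangMills.Theorems.BalabanUVNodesN15KingModelTreeGraphKing

/-!
# BalabanUVNodes ∕ N15 — THE KING-MODEL RUNG (PART Γ-c): **PROPOSITION 3.6's POWER COUNTING FOR GENERAL GRAPHS, BY NAME AT `A = 0` — THE SIZE HALF**: every
# numbered graph whose internal lines carry King's full `A = 0` propagator `G^η_k` or its η-gradient has `|E^{(k)}(H)| ≤ Γ·C₁^m·C₂^n·(Σ_π Π_i (1 − L^{−D_i(π)})^{−1})·Π q`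
# UNIFORMLY IN THE NUMBER OF SCALES `k`, provided the partial degrees along every ordering of the lines are positive
# (Track A, DAG node N15 = NE2; FAN-OUT v1.1 §N15 s3 «KING-MODEL RUNG … NE2's analogue DECIDED in the model»)

HONEST FRAMING.  Count-neutral (cell `pub-ymgap`, seat `pub-ymgap-dag-n15-e` g27; `--supports stmt-QuantumFields-27366 --as helper` = K3⁸
`SpineGivenEndpointR13SepCoPHV`).  TEMPLATE LITERATURE: C. King, *The U(1) Higgs model. I. The continuum limit*, Commun. Math. Phys. **102** (1986) 649–677
[King1986], proof of Proposition 3.6, pp. 663–664, for KING's OWN `A = 0` PROPAGATOR (2.13)∕(2.17): Proposition 3.7 BY NAME (part Ρ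
`prop37PrintedAt_king_zeroField`), (2.17) exact (part Ι-c `kingGLine_eq_sum_sliceLine` ⇐ part Χ-e), the generic graph half (part Γ-a) and the orderings ∕ slices
assembly (part Γ-b).  Parts Ι-a–Ι-f gave (3.56) for TREE graphs; this file gives its SIZE half for GENERAL graphs (loops allowed) under King's positivity of the
degrees — UV-finiteness of such graphs in the model, uniform in `k`.  King's U(1)∕`A = 0` MODEL; NOT Bałaban's non-abelian `G(U)` of [B9]; NOT a node discharge;
nothing continuum ∕ ℝ⁴ ∕ OS ∕ mass-gap ∕ Clay.  0 `sorry`; standard axioms.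
THE PRINT.  p. 663 [PDF 15]: *«Every internal line in H carries a propagator G_k, G_k(□) or one of their derivatives, which may be decomposed by writing
G_k = Σ_{j=0}^{k−1} G_{(j)}, see (2.17). The resulting product of sums is multiplied out and rewritten as a sum over orderings … (3.58) … (3.59)»*; p. 664 [PDF 16]:
*«Some of the subgraphs H_i may be divergent. In Sect. 3.5, we will show how graphs may be added together to form renormalised graphs, in which every subgraph
has positive degree. We will assume below that this has been done already … We get an upper bound for this expression by replacing every propagator by the
bounds given in Proposition 3.7 … We then sum over y, giving (3.68) … we get altogether the exponent D(H₁) … (3.69) … (3.70) … eventually shrinking H to one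
point x. The final sum over j is then bounded by C, and the sum over x by |□′| … Finally, there is a sum over orderings of the lines, again depending only on n̄.»*
WHAT THIS FILE PROVES (namespace `…N15KingModelRung.Curved`; `D = kingSliceKernels L k e_M M a m²` the `k`-level datum on `T_η = Tor (fine (L^k) M)`, `η = L^{−k}`).
* §1 ★ `abs_sliceLine_le_sup` ((3.63) with the decay dropped — a LOOP line's contribution: `|sliceLine D j κ x y| ≤ C·(L^jη)^{lineExp κ}` ⇐ `Prop37PrintedAt`),
  ★ `lineSum_sliceLine_le_col` (the column vertex sum by `tdistT_symm` + part Ι-c `lineSum_profile_le`), `lineSum_sliceLine_le_row` (part Ι-c's row sum with the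
  exponent spelled `lineExp + (d+1)`).
* §2 ★ `graphValLS_kingGLine_eq_sum` — (2.17) MULTIPLIED OUT: `E^{(k)}(H) = Σ_{j : lines → Fin k} E^{(k)}(H(j))` for the flat graph value (part Η-a `graphValLS`) with
  `kingGLine … k (κ ℓ)` on the lines; `abs_graphValLS_le` (`|E(H)| ≤ 𝔼(H)`, part Η-a `norm_graphVal_le` in the line ∕ site spelling).
* §3 ★★★ **`king_graph_size_uniform_zeroField`** — for odd `L ≥ 3`, `a > 0`, `m₀² ≥ 0` THERE ARE `C₁, C₂ > 0` such that for every `k ≥ 1`, cube `2L^{e_M}`, mass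
  `0 < m² ≤ m₀²`, every numbered graph (`src tgt : Fin m → Fin (n+1)`, kinds `κ`, lines `G^η_k`∕`∂^η_μG^η_k`), one-vertex factors `|u_υ| ≤ q_υ` with a root-placed
  `L¹` factor `υ₀` (`Σ_x η^{d+1}|u_{υ₀}| ≤ Γ`), and certificates `cert : Perm (Fin m) → ForestCert n src tgt` with `PosDegrees (orderList (d+1) (lineExp ∘ κ) π (cert π))`
  for every `π`: `|E^{(k)}(H)| ≤ Γ·C₁^m·C₂^n·(Σ_π degConst L (orderList …))·Π_{υ ≠ υ₀} q_υ` — UNIFORMLY IN `k`.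
HONEST SCOPE.  (a) The SIZE half of (3.56) (UV-finiteness uniform in the number of scales); the RATE `L^{−γk}` for general graphs is part Γ-d.  (b) The positivity
of the partial degrees along every ordering is a HYPOTHESIS — King's §3.5 (renormalised graphs) ∕ Thm 3.5, which MAKE the degrees of his graphs positive, are
NOT typed; the certificates (which lines are tree lines, per ordering) are user data — Kruskal's forest reproduces King's `D(H_i) = (d+1)(|V(H_i)| − c(H_i)) +
Σ lineExp`, any forest gives a valid weaker list.  (c) Lines `G`, `∂_μG` (`lineExp = 2 − (d+1)`, `1 − (d+1)`); `∂G∂*` lines and the contour ∕ Hölder kernels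
(3.64)∕(3.65) are not placed; «extra factors η at x and y» not modelled (fold into `q_υ`).  (d) (3.56)'s exponential tree decay between EXTERNAL points is not
displayed (root factor in `L¹` = King's `|□′|`).  (e) King's U(1)∕`A = 0` model, cubes `2L^{e_M}`, odd `L ≥ 3`, constants per `(a, m₀², L)` at `α = ½` of part Ρ;
NOT Bałaban's `G(U)`; NE2∕N15 of record untouched; counts unmoved.  Locators: [King1986] Prop. 3.6 (3.56) p.662, (2.17) p.653, (3.58)–(3.59) p.663, Prop. 3.7
(3.63) p.663, (3.66) p.663 (foot), (3.67)–(3.70) p.664.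
-/
noncomputable section

namespace Summit.QuantumFields.YangMills.BalabanUVNodes.N15KingModelRung.Curved

open scoped BigOperators
open Finset
open Literature.MathematicalPhysics.QuantumFieldTheory.Balaban1983to89.B5Prop11Plancherel (Tor fine unitVec)
open Literature.MathematicalPhysics.QuantumFieldTheory.King1986 (aK)
open Literature.MathematicalPhysics.QuantumFieldTheory.King1986.Torus (tdistT tdistT_nonneg tdistT_symm constrainedProp)
open Literature.MathematicalPhysics.QuantumFieldTheory.King1986.SlicePropagator (SliceKernels TwoSpacing Prop37PrintedAt Prop39PrintedAt)
open Literature.MathematicalPhysics.QuantumFieldTheory.King1986.ContinuumLimit (eps)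
open Summit.QuantumFields.YangMills.BalabanUVNodes.N15KingModelRung.Graph

variable {d : ℕ} (L : ℕ) [NeZero L]

/-! ## §1 Letters: the sup of a slice ((3.63) without the decay), the column sum of a slice -/

section Letters

/-- ★ **THE SUP OF A SLICE — (3.63) WITH THE DECAY DROPPED** (what a LOOP-closing line contributes: after the shrinking both its endpoints sit at the same
point): under `Prop37PrintedAt α D C δ₀` for the `k`-level datum, `|sliceLine D j κ x y| ≤ C·(L^jη)^{lineExp κ}` for every slice `j + 1 ≤ k`, kind and pair.
[cite: King1986, Prop. 3.7 (3.63) p.663, p.664 (proof of Prop. 3.6)] -/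
theorem abs_sliceLine_le_sup {a msq : ℝ} {k eM : ℕ} (hk : 1 ≤ k) (M : Fin (d + 1) → ℕ) [∀ μ, NeZero (M μ)]
    (hM : ∀ μ, M μ = 2 * L ^ eM) {α C δ₀ : ℝ} (hC : 0 ≤ C) (hδ₀ : 0 ≤ δ₀)
    (h37 : Prop37PrintedAt α (kingSliceKernels L k eM M hM hk a msq) C δ₀)
    {j : ℕ} (hj : j + 1 ≤ k) (κ : Option (Fin (d + 1))) (x y : Tor (fine (L ^ k) M)) :
    |sliceLine (kingSliceKernels L k eM M hM hk a msq) j κ x y| ≤ C * ((L : ℝ) ^ j * eps L k) ^ lineExp (d + 1) κ := by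
  have hL0 : (0 : ℝ) < L := by exact_mod_cast Nat.pos_of_ne_zero (NeZero.ne L)
  obtain ⟨h1, -, -⟩ := h37 j hj
  have hpt : |sliceLine (kingSliceKernels L k eM M hM hk a msq) j κ x y|
      ≤ C * ((L : ℝ) ^ j * eps L k) ^ lineExp (d + 1) κ
          * Real.exp (-(δ₀ * ((L : ℝ) ^ j * eps L k)⁻¹ * (tdistT (fine (L ^ k) M) x y / (L : ℝ) ^ k))) := by
    rcases κ with _ | μ
    · exact (h1 x y).1
    · exact (h1 x y).2 μ
  have hs : 0 < (L : ℝ) ^ j * eps L k := by unfold eps; positivity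
  have hexp : Real.exp (-(δ₀ * ((L : ℝ) ^ j * eps L k)⁻¹ * (tdistT (fine (L ^ k) M) x y / (L : ℝ) ^ k))) ≤ 1 := by
    rw [Real.exp_le_one_iff, neg_nonpos]
    exact mul_nonneg (mul_nonneg hδ₀ (inv_nonneg.2 hs.le)) (div_nonneg (tdistT_nonneg _ x y) (pow_nonneg hL0.le _))
  have hCs : 0 ≤ C * ((L : ℝ) ^ j * eps L k) ^ lineExp (d + 1) κ := mul_nonneg hC (Real.rpow_nonneg hs.le _)
  calc |sliceLine (kingSliceKernels L k eM M hM hk a msq) j κ x y|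
      ≤ C * ((L : ℝ) ^ j * eps L k) ^ lineExp (d + 1) κ
          * Real.exp (-(δ₀ * ((L : ℝ) ^ j * eps L k)⁻¹ * (tdistT (fine (L ^ k) M) x y / (L : ℝ) ^ k))) := hpt
    _ ≤ C * ((L : ℝ) ^ j * eps L k) ^ lineExp (d + 1) κ * 1 := mul_le_mul_of_nonneg_left hexp hCs
    _ = C * ((L : ℝ) ^ j * eps L k) ^ lineExp (d + 1) κ := mul_one _

/-- ★ **PROPOSITION 3.7 SUMMED OVER THE OTHER VERTEX** (the column sum; the (3.63) profile is symmetric in `x, y` by `tdistT_symm`):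
`Σ_x η^{d+1}·|sliceLine D j κ x y| ≤ C·c368·(L^jη)^{lineExp κ + (d+1)}` — a tree line may be oriented either way in the certificate.
[cite: King1986, Prop. 3.7 (3.63) p.663, (3.68) p.664] -/
theorem lineSum_sliceLine_le_col (hL : 1 ≤ L) {a msq : ℝ} {k eM : ℕ} (hk : 1 ≤ k) (M : Fin (d + 1) → ℕ) [∀ μ, NeZero (M μ)]
    (hM : ∀ μ, M μ = 2 * L ^ eM) {α C δ₀ : ℝ} (hC : 0 ≤ C) (hδ₀ : 0 < δ₀)
    (h37 : Prop37PrintedAt α (kingSliceKernels L k eM M hM hk a msq) C δ₀)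
    {j : ℕ} (hj : j + 1 ≤ k) (κ : Option (Fin (d + 1))) (y : Tor (fine (L ^ k) M)) :
    ∑ x : Tor (fine (L ^ k) M), (((L : ℝ) ^ k)⁻¹) ^ (d + 1) * |sliceLine (kingSliceKernels L k eM M hM hk a msq) j κ x y|
      ≤ C * c368 d δ₀ * ((L : ℝ) ^ j * eps L k) ^ (lineExp (d + 1) κ + ((d + 1 : ℕ) : ℝ)) := by
  obtain ⟨h1, -, -⟩ := h37 j hj
  have hpt : ∀ x, |sliceLine (kingSliceKernels L k eM M hM hk a msq) j κ x y|
      ≤ C * ((L : ℝ) ^ j * eps L k) ^ lineExp (d + 1) κ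
          * Real.exp (-(δ₀ * ((L : ℝ) ^ j * eps L k)⁻¹ * (tdistT (fine (L ^ k) M) y x / (L : ℝ) ^ k))) := by
    intro x
    rw [tdistT_symm _ y x]
    rcases κ with _ | μ
    · exact (h1 x y).1
    · exact (h1 x y).2 μ
  calc ∑ x : Tor (fine (L ^ k) M), (((L : ℝ) ^ k)⁻¹) ^ (d + 1) * |sliceLine (kingSliceKernels L k eM M hM hk a msq) j κ x y|
      ≤ ∑ x : Tor (fine (L ^ k) M), (((L : ℝ) ^ k)⁻¹) ^ (d + 1) * (C * ((L : ℝ) ^ j * eps L k) ^ lineExp (d + 1) κ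
          * Real.exp (-(δ₀ * ((L : ℝ) ^ j * eps L k)⁻¹ * (tdistT (fine (L ^ k) M) y x / (L : ℝ) ^ k)))) :=
        sum_le_sum fun x _ => mul_le_mul_of_nonneg_left (hpt x) (by positivity)
    _ ≤ C * c368 d δ₀ * ((L : ℝ) ^ j * eps L k) ^ (lineExp (d + 1) κ + ((d + 1 : ℕ) : ℝ)) :=
        lineSum_profile_le L hL hC hδ₀ k j M (lineExp (d + 1) κ) y

/-- the row sum with the exponent spelled `lineExp + (d+1)` (part Ι-c `lineSum_sliceLine_le` states it with `lineDeg`). [cite: King1986, (3.63) p.663, (3.68) p.664] -/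
theorem lineSum_sliceLine_le_row (hL : 1 ≤ L) {a msq : ℝ} {k eM : ℕ} (hk : 1 ≤ k) (M : Fin (d + 1) → ℕ) [∀ μ, NeZero (M μ)]
    (hM : ∀ μ, M μ = 2 * L ^ eM) {α C δ₀ : ℝ} (hC : 0 ≤ C) (hδ₀ : 0 < δ₀)
    (h37 : Prop37PrintedAt α (kingSliceKernels L k eM M hM hk a msq) C δ₀)
    {j : ℕ} (hj : j + 1 ≤ k) (κ : Option (Fin (d + 1))) (x : Tor (fine (L ^ k) M)) :
    ∑ y : Tor (fine (L ^ k) M), (((L : ℝ) ^ k)⁻¹) ^ (d + 1) * |sliceLine (kingSliceKernels L k eM M hM hk a msq) j κ x y|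
      ≤ C * c368 d δ₀ * ((L : ℝ) ^ j * eps L k) ^ (lineExp (d + 1) κ + ((d + 1 : ℕ) : ℝ)) := by
  rw [lineExp_add_dim]
  exact lineSum_sliceLine_le L hL hk M hM hC hδ₀ h37 hj κ x

end Letters

/-! ## §2 (2.17) multiplied out: `E^{(k)}(H) = Σ_j E^{(k)}(H(j))`; the majorant graph of a graph -/

section MultiplyOut

variable {Λ Υ V : Type*} [Fintype Λ] [DecidableEq Λ] [Fintype Υ] [Fintype V] [DecidableEq V]

/-- ★ **«THE RESULTING PRODUCT OF SUMS IS MULTIPLIED OUT»**: with King's full `A = 0` propagators `G^η_k`∕`∂^η_μG^η_k` on the internal lines, (2.17) on every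
line gives `E^{(k)}(H) = Σ_{j : lines → slices} E^{(k)}(H(j))`, the same graph with the slice `G^η_{(j_ℓ)}`∕`∂^η_μG^η_{(j_ℓ)}` on the line `ℓ`.
[cite: King1986, (2.17) p.653, (3.58)–(3.59) p.663 («may be decomposed by writing G_k = Σ_{j=0}^{k−1} G_{(j)} … The resulting product of sums is multiplied out»)] -/
theorem graphValLS_kingGLine_eq_sum (hL : 2 ≤ L) {a : ℝ} (ha : 0 < a) {k eM : ℕ} (hk : 1 ≤ k) (M : Fin (d + 1) → ℕ) [∀ μ, NeZero (M μ)]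
    (hM : ∀ μ, M μ = 2 * L ^ eM) {msq : ℝ} (hmsq : 0 < msq) (w : ℝ) (src tgt : Λ → V) (κ : Λ → Option (Fin (d + 1))) (vtx : Υ → V)
    (u : Υ → Tor (fine (L ^ k) M) → ℝ) :
    graphValLS w src tgt (fun ℓ => kingGLine L M a msq k (κ ℓ)) vtx u
      = ∑ j : Λ → Fin k, graphValLS w src tgt
          (fun ℓ (x y : Tor (fine (L ^ k) M)) => sliceLine (kingSliceKernels L k eM M hM hk a msq) (j ℓ) (κ ℓ) x y) vtx u := by
  unfold graphValLS
  have hline : ∀ σ : V → Tor (fine (L ^ k) M), ∏ ℓ, kingGLine L M a msq k (κ ℓ) (σ (src ℓ)) (σ (tgt ℓ))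
      = ∑ j : Λ → Fin k, ∏ ℓ, (fun (ℓ : Λ) (c : Fin k) =>
          sliceLine (kingSliceKernels L k eM M hM hk a msq) (c : ℕ) (κ ℓ) (σ (src ℓ)) (σ (tgt ℓ))) ℓ (j ℓ) := by
    intro σ
    refine Eq.trans (prod_congr rfl fun ℓ _ => ?_)
      (Fintype.prod_sum fun (ℓ : Λ) (c : Fin k) => sliceLine (kingSliceKernels L k eM M hM hk a msq) (c : ℕ) (κ ℓ) (σ (src ℓ)) (σ (tgt ℓ)))
    rw [kingGLine_eq_sum_sliceLine L hL ha hk M hM hmsq (κ ℓ)]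
    exact (Fin.sum_univ_eq_sum_range
      (fun c => sliceLine (kingSliceKernels L k eM M hM hk a msq) c (κ ℓ) (σ (src ℓ)) (σ (tgt ℓ))) k).symm
  simp_rw [hline, sum_mul, mul_sum]
  exact sum_comm

omit [DecidableEq Λ] in
/-- **THE MAJORANT GRAPH OF A GRAPH**: `|E(H)| ≤ 𝔼(H)`, the same graph run on `|w|`, `|G_ℓ|`, `|u_υ|` (part Η-a `norm_graphVal_le` in the line ∕ site spelling).
[cite: King1986, p.664 («We get an upper bound for this expression by replacing every propagator by the bounds …»)] -/
theorem abs_graphValLS_le {S : Type*} [Fintype S] (w : ℝ) (src tgt : Λ → V) (G : Λ → S → S → ℝ) (vtx : Υ → V) (u : Υ → S → ℝ) :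
    |graphValLS w src tgt G vtx u| ≤ graphValLS |w| src tgt (fun ℓ x y => |G ℓ x y|) vtx (fun υ x => |u υ x|) := by
  rw [graphValLS_eq_graphVal (𝕜 := ℝ), graphValLS_eq_graphVal (𝕜 := ℝ), ← Real.norm_eq_abs, ← Real.norm_eq_abs]
  refine norm_graphVal_le w _ _ fun φ σ => ?_
  rcases φ with ℓ | υ
  · simp only [lsFactor_inl, Real.norm_eq_abs]; exact le_rfl
  · simp only [lsFactor_inr, Real.norm_eq_abs]; exact le_rfl

end MultiplyOut

/-! ## §3 UV-finiteness of general graphs in the model: the size half of (3.56), uniformly in the number of scales -/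

section Size

/-- ★★★ **THE SIZE OF A GENERAL GRAPH WITH KING's FULL `A = 0` PROPAGATORS ON ITS LINES IS BOUNDED UNIFORMLY IN THE NUMBER OF SCALES — PROPOSITION
3.6's POWER COUNTING, SIZE HALF, BY NAME AT `A = 0`.**  For odd `L ≥ 3`, `a > 0`, `m₀² ≥ 0` there are `C₁, C₂ > 0` (Prop. 3.7's constant per line, (3.68)'s
per vertex) such that for every `k ≥ 1`, cube `M = 2L^{e_M}`, mass `0 < m² ≤ m₀²`, every NUMBERED graph — vertices `0, …, n` (external vertex `0`), internal
lines `0, …, m−1` with endpoints `src`, `tgt` and kinds `κ` (the line `ℓ` carries `G^η_k` or `∂^η_μG^η_k`, King's full `A = 0` propagator (2.13)),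
one-vertex factors `u_υ` at `vtx υ` with sizes `|u_υ| ≤ q_υ` and a root-placed factor `υ₀` with `Σ_x η^{d+1}|u_{υ₀}(x)| ≤ Γ` (King's `|□′|`) — and every
family of spanning-forest certificates `cert π`, one per ordering `π` of the lines, whose exponent lists (loop line: `lineExp κ` = `2 − (d+1)` ∕ `1 − (d+1)`;
tree line: `lineExp κ + (d+1)` = `lineDeg κ`) have POSITIVE PARTIAL DEGREES (King's «every subgraph `H_i` has positive degree», here a hypothesis):
`|E^{(k)}(H)| ≤ Γ·C₁^m·C₂^n·(Σ_π Π_i (1 − L^{−D_i(π)})^{−1})·Π_{υ ≠ υ₀} q_υ`, where `E^{(k)}(H) = graphValLS η^{d+1} src tgt (kingGLine … k ∘ κ) vtx u`.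
ASSEMBLY: (2.17) multiplied out (§2) ⇒ `|E| ≤ Σ_j 𝔼(H(j))` ⇒ part Γ-b `sum_graphValLS_slices_le` with Prop. 3.7 by name (part Ρ `prop37PrintedAt_king_zeroField` at
`α = ½`): sups by `abs_sliceLine_le_sup`, vertex sums by part Ι-c `lineSum_sliceLine_le` ∕ §1 `lineSum_sliceLine_le_col`.
[cite: King1986, Prop. 3.6 (3.56) p.662, (2.17) p.653, (3.58)–(3.59) p.663, Prop. 3.7 (3.63) p.663, (3.66)–(3.70) p.664] -/
theorem king_graph_size_uniform_zeroField (hLodd : Odd L) (hL : 2 ≤ L) {a : ℝ} (ha : 0 < a) {m0sq : ℝ} (hm0 : 0 ≤ m0sq) :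
    ∃ C₁ C₂ : ℝ, 0 < C₁ ∧ 0 < C₂ ∧ ∀ (k eM : ℕ) (hk : 1 ≤ k) (M : Fin (d + 1) → ℕ) [∀ μ, NeZero (M μ)] (hM : ∀ μ, M μ = 2 * L ^ eM)
      (msq : ℝ), 0 < msq → msq ≤ m0sq →
      ∀ (n m : ℕ) (src tgt : Fin m → Fin (n + 1)) (κ : Fin m → Option (Fin (d + 1)))
        (Υ : Type) [Fintype Υ] [DecidableEq Υ] (vtx : Υ → Fin (n + 1)) (u : Υ → Tor (fine (L ^ k) M) → ℝ) (q : Υ → ℝ) (υ₀ : Υ) (Γ : ℝ),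
        vtx υ₀ = 0 → (∀ υ, υ ≠ υ₀ → ∀ x, |u υ x| ≤ q υ) → (∑ x, (((L : ℝ) ^ k)⁻¹) ^ (d + 1) * |u υ₀ x| ≤ Γ) →
        ∀ cert : Equiv.Perm (Fin m) → ForestCert n src tgt,
          (∀ π, PosDegrees (orderList ((d + 1 : ℕ) : ℝ) (fun ℓ => lineExp (d + 1) (κ ℓ)) π (cert π))) →
          |graphValLS ((((L : ℝ) ^ k)⁻¹) ^ (d + 1)) src tgt (fun ℓ => kingGLine L M a msq k (κ ℓ)) vtx u|
            ≤ Γ * (C₁ ^ m * C₂ ^ n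
                * (∑ π : Equiv.Perm (Fin m), degConst L (orderList ((d + 1 : ℕ) : ℝ) (fun ℓ => lineExp (d + 1) (κ ℓ)) π (cert π)))
                * ∏ υ ∈ univ.erase υ₀, q υ) := by
  obtain ⟨C, δ₀, hC, hδ₀, H⟩ := prop37PrintedAt_king_zeroField (d := d) L hLodd hL ha hm0 (α := 1 / 2) (by norm_num) (by norm_num)
  refine ⟨C, c368 d δ₀, hC, c368_pos d hδ₀,
    fun k eM hk M _ hM msq hm hcap n m src tgt κ Υ _ _ vtx u q υ₀ Γ hυ₀ hq hΓ cert hpos => ?_⟩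
  have h37 := H k eM hk M hM msq hm hcap
  have hL1 : 1 ≤ L := by omega
  have hw0 : (0 : ℝ) ≤ (((L : ℝ) ^ k)⁻¹) ^ (d + 1) := by positivity
  haveI : Nonempty (Tor (fine (L ^ k) M)) := ⟨fun _ => 0⟩
  -- (2.17) multiplied out, the majorant graph of each `H(j)`
  rw [graphValLS_kingGLine_eq_sum L hL ha hk M hM hm _ src tgt κ vtx u]
  refine (Finset.abs_sum_le_sum_abs _ _).trans ?_
  refine (sum_le_sum fun j _ => abs_graphValLS_le _ src tgt _ vtx u).trans ?_
  rw [abs_of_nonneg hw0]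
  -- part Γ-b with Prop. 3.7 by name
  exact sum_graphValLS_slices_le L hL hk vtx hw0
    (fun ℓ (c : Fin k) (x y : Tor (fine (L ^ k) M)) => |sliceLine (kingSliceKernels L k eM M hM hk a msq) (c : ℕ) (κ ℓ) x y|)
    (fun ℓ c x y => abs_nonneg _) hC.le (c368_pos d hδ₀).le (((d + 1 : ℕ) : ℝ)) (fun ℓ => lineExp (d + 1) (κ ℓ))
    (fun ℓ c x y => abs_sliceLine_le_sup L hk M hM hC.le hδ₀.le h37 (by have := c.isLt; omega) (κ ℓ) x y)
    (fun ℓ c y => lineSum_sliceLine_le_row L hL1 hk M hM hC.le hδ₀ h37 (by have := c.isLt; omega) (κ ℓ) y)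
    (fun ℓ c y => lineSum_sliceLine_le_col L hL1 hk M hM hC.le hδ₀ h37 (by have := c.isLt; omega) (κ ℓ) y)
    (fun υ x => |u υ x|) (fun υ x => abs_nonneg _) υ₀ hυ₀ hΓ q hq cert hpos

end Size

end Summit.QuantumFields.YangMills.BalabanUVNodes.N15KingModelRung.Curved

end
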